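import Literature.NumberTheory.ConnesConsani2021.ProlateCommutation
import HarnessLib

/-!
# `CC2021_sec4_xi_complete` — the discharge (row O10 of cell rh-crit: modules (a) `ProlateSincOperator`,
# `ProlateIdentification` (seat t10), (b) `ProlateCommutation` (seat t3), (c) this file)

LINE 1 — FRAMING: RH-FREE classical analysis (Slepian–Pollak 1961 §III: the even prolate spheroidal wave
functions are complete in `L²([−1,1])_even`); cell rh-crit, corpus C1; bears_on: W-C/W-P (apex (A), K1
binders hii/h46i/hsp via seat t2's `_of_xi_complete` reductions and t4's
`CC2021_thm_4_7_weak_of_prop_2_2_iii_of_xi_complete`).  WHAT THIS IS NOT: any claim about RH — nothing here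
bears on the truth of RH.

Topic `NumberTheory/ConnesConsani2021`; namespace `Literature.NumberTheory.ConnesConsani2021`.  One theorem.

The named fact `CC2021_sec4_xi_complete` (`ProlateProjections.lean`): an even `ξ ∈ L²(ℝ)` with `𝒫₁ξ = ξ`
orthogonal to all `ξ_n = prolateXi n` vanishes.  PROOF ROAD (all in the tree): the sinc operator
`K = 𝒫₁𝒫̂₁𝒫₁` on `L²([−1,1])` is compact self-adjoint with `ker K = 0` and commutes with the reflection;
Hilbert eigenbasis + even/odd splitting reduce the statement to «every a.e.-even eigenvector of `K` with
eigenvalue `ν ≠ 0` lies in `span {prolateXiI n}`» (`CC2021_sec4_xi_complete_of_commutation`,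
`ProlateSincOperator.lean`); that statement is `even_eigenvector_mem_span_prolateXiI`
(`ProlateCommutation.lean`, seat t3: Slepian's commutation `[𝐖, K] = 0`, Green's identity, joint
diagonalisation on the finite-dimensional `E_ν^even`, and the identification of even solutions of the prolate
equation with the tree prolate functions via `ProlateIdentification.lean`).

## References

* D. Slepian, H. O. Pollak, *Prolate spheroidal wave functions, Fourier analysis and uncertainty — I*, Bell
  System Tech. J. 40 (1961) 43–63, §III. [SlepianPollak1961]
* A. Connes, C. Consani, *Weil positivity and trace formula, the archimedean place*, Selecta Math. 27 (2021),
  Prop. 4.5 (i) §4 p. 16 (arXiv:2006.13771 p0016:L48–L52). [ConnesConsani2021]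
-/

noncomputable section

namespace Literature.NumberTheory.ConnesConsani2021

/-- **CC 2021 §4 / Slepian–Pollak 1961 §III: the even prolate functions `ξ_n` are complete in the range of
`𝒫₁` on even `L²(ℝ)`** — discharge of the named fact `CC2021_sec4_xi_complete`.
[cite: ConnesConsani2021, Prop. 4.5 (i) §4 p. 16 (arXiv p0016:L48–L52); SlepianPollak1961, §III] -/
theorem CC2021_sec4_xi_complete_holds : CC2021_sec4_xi_complete :=
  CC2021_sec4_xi_complete_of_commutation
    fun K hK hKc hKsa {_ν} hν {_S} hS hev => even_eigenvector_mem_span_prolateXiI K hK hKc hKsa hν hS hev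

end Literature.NumberTheory.ConnesConsani2021
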